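import Literature.AlgebraicGeometry.DeterminantalHypersurfaces.KernerVinnikovDecomposability
import Literature.AlgebraicGeometry.DeterminantalHypersurfaces.KernerVinnikovSaturation
import Literature.AlgebraicGeometry.DeterminantalHypersurfaces.KernerVinnikovBlocks
import Literature.AlgebraicGeometry.DeterminantalHypersurfaces.KernerVinnikovGlobal
import Mathlib.Data.Fin.SuccPred
import HarnessLib

/-!
# Kerner–Vinnikov: global-from-local decomposability — proof of the named fact

Discharges `KernerVinnikov2012_globallyDecomposable_iff` (`KernerVinnikovDecomposability.lean`):
D. Kerner, V. Vinnikov, *Determinantal representations of singular hypersurfaces in ℙⁿ*,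
Adv. Math. 231 (2012) 1619–1654 (arXiv:0906.3012), §3 **Thm. 3.1** with the Proposition
following it (part 1).

## The proof (following the printed proof of Thm. 3.1)

* `⇒` (global ⇒ local) "obviously": the global block form, base-changed to `𝒪_a`, is a local
  one with `r = 0`.
* `⇐`, **Part 1** (printed: local decomposability ⇒ every entry of `ℳ^∨ = adj M` lies in the
  local ideal `(f₁, f₂)` at every point; Noether's `AF + BG` ⇒ `adj M = f₂ N₁ + f₁ N₂`):
  `exists_mul_adjugate_mem_span_pair_of_local` (local half, `KernerVinnikovBlocks.lean`), then
  the Nullstellensatz (`exists_pow_mul_mem_of_forall_point`) and the elementary saturation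
  engine `mem_span_pair_of_pow_linear_mul_mem` (`KernerVinnikovSaturation.lean`) in place of the
  general `AF + BG` theorem, for `n ≥ 2`; for `n = 1` (where `X₁ ∩ X₂ = ∅` and the printed
  argument degenerates) Sylvester's dimension count `binaryForm_mem_span_pair`; `n = 0` is
  vacuous (`not_isRelPrime_of_isHomogeneous_fin_one`).
* `⇐`, **Part 2** (printed, verbatim): `exists_blockDecomposition_of_adjugate_mem_span_pair`
  (`KernerVinnikovGlobal.lean`).

Main result: `KernerVinnikov2012_globallyDecomposable_iff_holds`.
-/

noncomputable section

open MvPolynomial Matrix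

namespace Literature.AlgebraicGeometry.DeterminantalHypersurfaces

/-- With `r = 0` the block placement `blockIndexEquiv` is `finSumFinEquiv` on the `N₁ ⊕ N₂` part.
[folklore] -/
theorem blockIndexEquiv_inr {d₁ d₂ : ℕ} (h : 0 + d₁ + d₂ = d₁ + d₂) (x : Fin d₁ ⊕ Fin d₂) :
    blockIndexEquiv h (Sum.inr x) = finSumFinEquiv x := by
  ext
  simp [blockIndexEquiv]

/-- **Part 1 of [KernerVinnikov2012, Thm. 3.1]** in the rendering of
`KernerVinnikov2012_globallyDecomposable_iff`: local decomposability at the points of `X₁ ∩ X₂`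
implies that every entry of `adj M` lies in `(f₁, f₂)`.
[cite: KernerVinnikov2012, §3, proof of Thm. 3.1, Part 1] -/
theorem adjugate_mem_span_pair_of_locallyDecomposable {k : Type} [Field k] [IsAlgClosed k]
    {n d₁ d₂ : ℕ} (hd₁ : 0 < d₁) (hd₂ : 0 < d₂) {f₁ f₂ : MvPolynomial (Fin (n + 1)) k}
    (hf₁ : f₁.IsHomogeneous d₁) (hf₂ : f₂.IsHomogeneous d₂) (hcop : IsRelPrime f₁ f₂)
    (M : Matrix (Fin (d₁ + d₂)) (Fin (d₁ + d₂)) (MvPolynomial (Fin (n + 1)) k))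
    (hM : ∀ i j, (M i j).IsHomogeneous 1)
    (hloc : ∀ a : Fin (n + 1) → k, a ≠ 0 → MvPolynomial.eval a f₁ = 0 →
      MvPolynomial.eval a f₂ = 0 →
      letI : (RingHom.ker (MvPolynomial.eval a)).IsPrime := RingHom.ker_isPrime (MvPolynomial.eval a)
      ∃ (r e₁ e₂ : ℕ) (h : r + e₁ + e₂ = d₁ + d₂)
        (A B : Matrix (Fin (d₁ + d₂)) (Fin (d₁ + d₂))
          (Localization.AtPrime (RingHom.ker (MvPolynomial.eval a))))
        (N₁ : Matrix (Fin e₁) (Fin e₁) (Localization.AtPrime (RingHom.ker (MvPolynomial.eval a))))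
        (N₂ : Matrix (Fin e₂) (Fin e₂) (Localization.AtPrime (RingHom.ker (MvPolynomial.eval a))))
        (u₁ u₂ : (Localization.AtPrime (RingHom.ker (MvPolynomial.eval a)))ˣ),
        IsUnit A ∧ IsUnit B ∧
          A * M.map (algebraMap (MvPolynomial (Fin (n + 1)) k)
                (Localization.AtPrime (RingHom.ker (MvPolynomial.eval a)))) * B =
            (Matrix.fromBlocks (1 : Matrix (Fin r) (Fin r) _) 0 0 (Matrix.fromBlocks N₁ 0 0 N₂)).reindex
              (blockIndexEquiv h) (blockIndexEquiv h) ∧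
          N₁.det = (u₁ : Localization.AtPrime (RingHom.ker (MvPolynomial.eval a))) *
              algebraMap (MvPolynomial (Fin (n + 1)) k) _ f₁ ∧
          N₂.det = (u₂ : Localization.AtPrime (RingHom.ker (MvPolynomial.eval a))) *
              algebraMap (MvPolynomial (Fin (n + 1)) k) _ f₂)
    (i j : Fin (d₁ + d₂)) : M.adjugate i j ∈ Ideal.span {f₁, f₂} := by
  have hf₁0 : f₁ ≠ 0 := ne_zero_of_isRelPrime_of_isHomogeneous hd₂ hf₂ hcop
  have hf₂0 : f₂ ≠ 0 := ne_zero_of_isRelPrime_of_isHomogeneous hd₁ hf₁ hcop.symm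
  have hf0 : f₁ * f₂ ≠ 0 := mul_ne_zero hf₁0 hf₂0
  rcases n with _ | _ | n
  · -- `n = 0`: vacuous
    exact absurd hcop (not_isRelPrime_of_isHomogeneous_fin_one hd₁ hd₂ hf₁ hf₂)
  · -- `n = 1`: Sylvester
    have hadjh := isHomogeneous_adjugate_of_linear hM i j
    rw [Fintype.card_fin] at hadjh
    exact binaryForm_mem_span_pair hd₁ hd₂ hf₁ hf₂ hf₁0 hcop hadjh
  · -- `n ≥ 2`: local-to-global
    have hloc' : ∀ a : Fin (n + 2 + 1) → k, a ≠ 0 →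
        ∃ s : MvPolynomial (Fin (n + 2 + 1)) k, eval a s ≠ 0 ∧
          s * M.adjugate i j ∈ Ideal.span {f₁, f₂} := by
      intro a ha
      by_cases h1 : eval a f₁ = 0
      · by_cases h2 : eval a f₂ = 0
        · obtain ⟨r, e₁, e₂, h, A, B, N₁, N₂, u₁, u₂, hA, hB, hABM, hN₁, hN₂⟩ := hloc a ha h1 h2
          letI : (RingHom.ker (MvPolynomial.eval a)).IsPrime := RingHom.ker_isPrime _
          exact exists_mul_adjugate_mem_span_pair_of_local h f₁ f₂ hf0 M a A B N₁ N₂ u₁ u₂ hA hB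
            hABM hN₁ hN₂ i j
        · exact ⟨f₂, h2, Ideal.mul_mem_right _ _ (Ideal.subset_span (by simp))⟩
      · exact ⟨f₁, h1, Ideal.mul_mem_right _ _ (Ideal.subset_span (by simp))⟩
    -- a point where `f₁` does not vanish, and three distinct coordinates
    obtain ⟨b, hb⟩ : ∃ b : Fin (n + 2 + 1) → k, eval b f₁ ≠ 0 := by
      by_contra hcon
      simp only [not_exists, ne_eq, not_not] at hcon
      exact hf₁0 (MvPolynomial.funext fun x => by simpa using hcon x)
    obtain ⟨i₀, hi₀⟩ : ∃ i₀, b i₀ ≠ 0 := by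
      by_contra hcon
      simp only [not_exists, ne_eq, not_not] at hcon
      have hb0 : b = 0 := funext hcon
      apply hb
      rw [hb0, MvPolynomial.eval_zero, constantCoeff_eq]
      exact hf₁.coeff_eq_zero (by simp; omega)
    obtain ⟨l, l', hl, hl', hll'⟩ : ∃ l l' : Fin (n + 2 + 1), l ≠ i₀ ∧ l' ≠ i₀ ∧ l ≠ l' := by
      have hcard : 1 < (Finset.univ.erase i₀ : Finset (Fin (n + 2 + 1))).card := by
        rw [Finset.card_erase_of_mem (Finset.mem_univ _), Finset.card_univ, Fintype.card_fin]
        omega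
      obtain ⟨l, l', hlm, hl'm, hne⟩ := Finset.one_lt_card_iff.mp hcard
      exact ⟨l, l', (Finset.mem_erase.mp hlm).1, (Finset.mem_erase.mp hl'm).1, hne⟩
    have hℓ0 : eval (0 : Fin (n + 2 + 1) → k) (X l - C (b l / b i₀) * X i₀) = 0 := by simp
    have hℓ'0 : eval (0 : Fin (n + 2 + 1) → k) (X l' - C (b l' / b i₀) * X i₀) = 0 := by simp
    obtain ⟨N, hN⟩ := exists_pow_mul_mem_of_forall_point (Ideal.span {f₁, f₂}) (M.adjugate i j)
      (X l - C (b l / b i₀) * X i₀) hℓ0 hloc'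
    obtain ⟨K, hK⟩ := exists_pow_mul_mem_of_forall_point (Ideal.span {f₁, f₂}) (M.adjugate i j)
      (X l' - C (b l' / b i₀) * X i₀) hℓ'0 hloc'
    exact mem_span_pair_of_pow_linear_mul_mem hl hl' hll' hi₀ hb hcop hN hK

/-- **Kerner–Vinnikov 2012, Thm. 3.1 with the Proposition following it (part 1)**: the named
fact `KernerVinnikov2012_globallyDecomposable_iff` holds.
[cite: KernerVinnikov2012, §3 Thm. 3.1 and the Proposition following it (part 1)] -/
theorem KernerVinnikov2012_globallyDecomposable_iff_holds :
    KernerVinnikov2012_globallyDecomposable_iff := by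
  intro k _ _ _ n d₁ d₂ hd₁ hd₂ f₁ f₂ hf₁ hf₂ hcop M hM hdet
  constructor
  · -- global ⇒ local
    rintro ⟨A, B, M₁, M₂, c₁, c₂, hA, hB, hc₁, hc₂, hABM, hM₁, hM₂⟩ a ha _ _
    letI : (RingHom.ker (MvPolynomial.eval a)).IsPrime := RingHom.ker_isPrime (MvPolynomial.eval a)
    set φ := algebraMap (MvPolynomial (Fin (n + 1)) k)
      (Localization.AtPrime (RingHom.ker (MvPolynomial.eval a))) with hφ
    have hu₁ : IsUnit (φ (C c₁)) := ((isUnit_iff_ne_zero.mpr hc₁).map C).map φ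
    have hu₂ : IsUnit (φ (C c₂)) := ((isUnit_iff_ne_zero.mpr hc₂).map C).map φ
    refine ⟨0, d₁, d₂, by simp, (A.map C).map φ, (B.map C).map φ, M₁.map φ, M₂.map φ,
      hu₁.unit, hu₂.unit, (hA.map C.mapMatrix).map φ.mapMatrix,
      (hB.map C.mapMatrix).map φ.mapMatrix, ?_, ?_, ?_⟩
    · rw [← Matrix.map_mul, ← Matrix.map_mul, hABM]
      ext i j
      have hi : (blockIndexEquiv (show 0 + d₁ + d₂ = d₁ + d₂ by simp)).symm i =
          Sum.inr (finSumFinEquiv.symm i) := by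
        rw [Equiv.symm_apply_eq, blockIndexEquiv_inr, Equiv.apply_symm_apply]
      have hj : (blockIndexEquiv (show 0 + d₁ + d₂ = d₁ + d₂ by simp)).symm j =
          Sum.inr (finSumFinEquiv.symm j) := by
        rw [Equiv.symm_apply_eq, blockIndexEquiv_inr, Equiv.apply_symm_apply]
      rw [Matrix.map_apply, Matrix.reindex_apply, Matrix.reindex_apply, Matrix.submatrix_apply,
        Matrix.submatrix_apply, hi, hj, Matrix.fromBlocks_apply₂₂]
      rcases finSumFinEquiv.symm i with i' | i' <;> rcases finSumFinEquiv.symm j with j' | j' <;>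
        simp
    · rw [IsUnit.unit_spec, ← map_mul, ← hM₁, RingHom.map_det, RingHom.mapMatrix_apply]
    · rw [IsUnit.unit_spec, ← map_mul, ← hM₂, RingHom.map_det, RingHom.mapMatrix_apply]
  · -- local ⇒ global
    intro hloc
    have hadj : ∀ i j, M.adjugate i j ∈ Ideal.span {f₁, f₂} := fun i j =>
      adjugate_mem_span_pair_of_locallyDecomposable hd₁ hd₂ hf₁ hf₂ hcop M hM hloc i j
    obtain ⟨A, B, M₁, M₂, c₁, c₂, hA, hB, hc₁, hc₂, hABM, hM₁, hM₂⟩ :=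
      exists_blockDecomposition_of_adjugate_mem_span_pair rfl hd₁ hd₂ hf₁ hf₂ hcop M hM hdet hadj
    refine ⟨A, B, M₁, M₂, c₁, c₂, hA, hB, hc₁, hc₂, ?_, hM₁, hM₂⟩
    rw [hABM, finCongr_refl, Equiv.trans_refl]

end Literature.AlgebraicGeometry.DeterminantalHypersurfaces
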